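import Summits.AtomisticToContinuum.BoseEinsteinCondensation.Theses.BECHardSphereReduction
import Summits.AtomisticToContinuum.BoseEinsteinCondensation.Theorems.BECHardSphereReductionHardSphereBECMajorityReduction
import Summits.AtomisticToContinuum.BoseEinsteinCondensation.Theorems.BECHardSphereReductionHardSphereBECPositivityTransferHS

/-!
# Crux `HardSphereBEC` (stmt-11885), line `birth` v5.3 — the kernel with a DENSITY-DEPENDENT majority constant

Route `BECHardSphereReduction`, lead c9 (2026-08-17).  `HS₁ = ⊤·1_{[0,1]}`, `L_N(η) = (N/η)^{1/3}`,
`φ₀ = L^{-3/2}·1_{Λ_L}`, `occ₀(Θ) = ⟨φ₀, γ_Θ φ₀⟩`.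

Skeleton v5 (lead c8) closed the crux modulo ONE stub S1⁺ = `stub_majorityPositiveZeroMode`, which asks
for ONE constant `c > 1/2` serving a whole density interval: `∃ c > 1/2, ∃ η₁ > 0, ∀ η ∈ (0, η₁), ∀ᶠ N, …`.
The composition never uses that uniformity: item 11888 `HardSphereZeroMode` and `HasGroundStateBEC` take a
density-dependent constant.  This file records the weaker, density-LOCAL kernel

  S1⁺_loc : `∃ η₁ > 0, ∀ η ∈ (0, η₁), ∃ c > 1/2, ∀ᶠ N, ∃ δ > 0`, every nonnegative `δ`-near-minimiser `Φ`
            of the HS₁ Dirichlet energy at `L_N(η)` has `occ₀(Φ) ≥ c N`,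

and proves that it still closes everything S1⁺ closed:

* `hardSphereZeroMode_of_localMajority` — item 11888 ⟸ S1⁺_loc (phase-sector transfer `phaseSectorTransfer`,
  p166880, at each density with that density's constant; `E₀ < ⊤` eventually for `η < 1/8`);
* `hardSphereBEC_of_localMajority` — the crux ⟸ S1⁺_loc (through `hardSphereBEC_of_zeroMode_of_scaling`,
  p97804, and the proved `hardSphereScaling_proof`);
* `localMajority_of_majority` — S1⁺ ⟹ S1⁺_loc (the reshape v5 → v5.3 is a weakening of the registered stub);
* `localMajority_of_generalMajority` — S1⁺_loc is VERBATIM the instance `v := HS₁` of the summit-wide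
  majority form of `PositiveZeroMode` (the hypothesis of `boseEinsteinCondensation_of_majorityPositiveZeroMode`,
  p166887), so ONE filed statement (majority PositiveZeroMode, density-dependent constant) serves this crux,
  item 11888 and the conjunct alike.
-/

noncomputable section

namespace Summit.AtomisticToContinuum.BoseEinsteinCondensation.Cruxes.HardSphereBEC.MajorityLocal

open MeasureTheory ENNReal Filter Literature.MathematicalPhysics.QuantumManyBody.BoseGas
open Summit.AtomisticToContinuum.BoseEinsteinCondensation.Theses.BECHardSphereReduction
open Summit.AtomisticToContinuum.BoseEinsteinCondensation.Theorems

/-- **Item 11888 `HardSphereZeroMode` from the density-LOCAL majority kernel S1⁺_loc**: for each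
`η < min η₁ (1/8)` take that density's constant `c > 1/2`; eventually in `N` the hard-sphere ground-state
energy at `L_N(η)` is finite (`eventually_groundStateEnergy_hardSphere_lt_top`), so the phase-sector transfer
(`MajorityReduction.phaseSectorTransfer`) turns the bound `cN` on nonnegative near-minimisers into
`(c − 1/2)N` on all near-minimisers. [folklore] -/
theorem hardSphereZeroMode_of_localMajority
    (h1 : ∃ η₁ : ℝ, 0 < η₁ ∧ ∀ η : ℝ, 0 < η → η < η₁ → ∃ c : ℝ, 1 / 2 < c ∧ ∀ᶠ N : ℕ in Filter.atTop, ∃ δ : ENNReal, 0 < δ ∧ ∀ Φ : Literature.MathematicalPhysics.QuantumManyBody.BoseGas.TrialState N (Literature.MathematicalPhysics.QuantumManyBody.BoseGas.sideLength η N), Literature.MathematicalPhysics.QuantumManyBody.BoseGas.energy (Set.indicator (Set.Iic 1) (fun _ : ℝ => (⊤ : ENNReal))) Φ ≤ Literature.MathematicalPhysics.QuantumManyBody.BoseGas.groundStateEnergy (Set.indicator (Set.Iic 1) (fun _ : ℝ => (⊤ : ENNReal))) N (Literature.MathematicalPhysics.QuantumManyBody.BoseGas.sideLength η N) + δ → (∀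 X, Φ.ψ X = (‖Φ.ψ X‖ : ℂ)) → ENNReal.ofReal (c * N) ≤ Literature.MathematicalPhysics.QuantumManyBody.BoseGas.occupation N ((Literature.MathematicalPhysics.QuantumManyBody.BoseGas.box (Literature.MathematicalPhysics.QuantumManyBody.BoseGas.sideLength η N)).indicator fun _ => ((Real.sqrt (Literature.MathematicalPhysics.QuantumManyBody.BoseGas.sideLength η N ^ 3))⁻¹ : ℂ)) Φ.ψ) :
    HardSphereZeroMode := by
  obtain ⟨η₁, hη₁, H⟩ := h1
  refine ⟨min η₁ (1 / 8), lt_min hη₁ (by norm_num), fun η hη hηlt => ?_⟩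
  have hη1 : η < η₁ := hηlt.trans_le (min_le_left _ _)
  have hη8 : η < 1 / 8 := hηlt.trans_le (min_le_right _ _)
  obtain ⟨c, hc, hev⟩ := H η hη hη1
  refine ⟨c - 1 / 2, by linarith, ?_⟩
  filter_upwards [hev, eventually_groundStateEnergy_hardSphere_lt_top hη hη8,
    eventually_gt_atTop 0] with N hN hE hN0
  obtain ⟨δ₁, hδ₁, hΦ⟩ := hN
  have hL : 0 < sideLength η N :=
    Real.rpow_pos_of_pos (div_pos (Nat.cast_pos.mpr hN0) hη) _
  exact MajorityReduction.phaseSectorTransfer _ N _ c δ₁ hc hL hE.ne hδ₁ hΦ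

/-- **The crux `HardSphereBEC` from the density-LOCAL majority kernel S1⁺_loc**: 11888 from
`hardSphereZeroMode_of_localMajority`, then the landed zero-mode criterion with the proved exact scale
covariance (`hardSphereBEC_of_zeroMode_of_scaling`, `hardSphereScaling_proof`). [folklore] -/
theorem hardSphereBEC_of_localMajority
    (h1 : ∃ η₁ : ℝ, 0 < η₁ ∧ ∀ η : ℝ, 0 < η → η < η₁ → ∃ c : ℝ, 1 / 2 < c ∧ ∀ᶠ N : ℕ in Filter.atTop, ∃ δ : ENNReal, 0 < δ ∧ ∀ Φ : Literature.MathematicalPhysics.QuantumManyBody.BoseGas.TrialState N (Literature.MathematicalPhysics.QuantumManyBody.BoseGas.sideLength η N), Literature.MathematicalPhysics.QuantumManyBody.BoseGas.energy (Set.indicator (Set.Iic 1) (fun _ : ℝ => (⊤ : ENNReal))) Φ ≤ Literature.MathematicalPhysics.QuantumManyBody.BoseGas.groundStateEnergy (Set.indicator (Set.Iic 1) (fun _ : ℝ => (⊤ : ENNReal))) N (Literature.MathematicalPhysics.QuantumManyBody.BoseGas.sideLength η N) + δ → (∀ X, Φ.ψ X = (‖Φ.ψ X‖ : ℂ)) →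 ENNReal.ofReal (c * N) ≤ Literature.MathematicalPhysics.QuantumManyBody.BoseGas.occupation N ((Literature.MathematicalPhysics.QuantumManyBody.BoseGas.box (Literature.MathematicalPhysics.QuantumManyBody.BoseGas.sideLength η N)).indicator fun _ => ((Real.sqrt (Literature.MathematicalPhysics.QuantumManyBody.BoseGas.sideLength η N ^ 3))⁻¹ : ℂ)) Φ.ψ) :
    HardSphereBEC :=
  hardSphereBEC_of_zeroMode_of_scaling (hardSphereZeroMode_of_localMajority h1) hardSphereScaling_proof

/-- **The reshape v5 → v5.3 is a weakening**: the registered v5 stub S1⁺ (one constant `c > 1/2` for the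
whole density interval) implies the density-local kernel S1⁺_loc (pick the same `c` at every `η`).
[folklore] -/
theorem localMajority_of_majority
    (h1 : ∃ c : ℝ, 1 / 2 < c ∧ ∃ η₁ : ℝ, 0 < η₁ ∧ ∀ η : ℝ, 0 < η → η < η₁ → ∀ᶠ N : ℕ in Filter.atTop, ∃ δ : ENNReal, 0 < δ ∧ ∀ Φ : Literature.MathematicalPhysics.QuantumManyBody.BoseGas.TrialState N (Literature.MathematicalPhysics.QuantumManyBody.BoseGas.sideLength η N), Literature.MathematicalPhysics.QuantumManyBody.BoseGas.energy (Set.indicator (Set.Iic 1) (fun _ : ℝ => (⊤ : ENNReal))) Φ ≤ Literature.MathematicalPhysics.QuantumManyBody.BoseGas.groundStateEnergy (Set.indicator (Set.Iic 1) (fun _ : ℝ => (⊤ : ENNReal))) N (Literature.MathematicalPhysics.QuantumManyBody.BoseGas.sideLength η N) + δ → (∀ X, Φ.ψ X = (‖Φ.ψ X‖ : ℂ)) → ENNReal.ofReal (c * N) ≤ Literature.MathematicalPhysics.QuantumManyBody.BoseGas.occupation N ((Literature.MathematicalPhysics.QuantumManyBody.BoseGas.box (Literature.MathematicalPhysics.QuantumManyBody.BoseGas.sideLength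 η N)).indicator fun _ => ((Real.sqrt (Literature.MathematicalPhysics.QuantumManyBody.BoseGas.sideLength η N ^ 3))⁻¹ : ℂ)) Φ.ψ) :
    ∃ η₁ : ℝ, 0 < η₁ ∧ ∀ η : ℝ, 0 < η → η < η₁ → ∃ c : ℝ, 1 / 2 < c ∧ ∀ᶠ N : ℕ in Filter.atTop, ∃ δ : ENNReal, 0 < δ ∧ ∀ Φ : Literature.MathematicalPhysics.QuantumManyBody.BoseGas.TrialState N (Literature.MathematicalPhysics.QuantumManyBody.BoseGas.sideLength η N), Literature.MathematicalPhysics.QuantumManyBody.BoseGas.energy (Set.indicator (Set.Iic 1) (fun _ : ℝ => (⊤ : ENNReal))) Φ ≤ Literature.MathematicalPhysics.QuantumManyBody.BoseGas.groundStateEnergy (Set.indicator (Set.Iic 1) (fun _ : ℝ => (⊤ : ENNReal))) N (Literature.MathematicalPhysics.QuantumManyBody.BoseGas.sideLength η N) + δ → (∀ X, Φ.ψ X = (‖Φ.ψ X‖ : ℂ)) → ENNReal.ofReal (c * N) ≤ Literature.MathematicalPhysics.QuantumManyBody.BoseGas.occupation N ((Literature.MathematicalPhysics.QuantumManyBody.BoseGas.box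 (Literature.MathematicalPhysics.QuantumManyBody.BoseGas.sideLength η N)).indicator fun _ => ((Real.sqrt (Literature.MathematicalPhysics.QuantumManyBody.BoseGas.sideLength η N ^ 3))⁻¹ : ℂ)) Φ.ψ := by
  obtain ⟨c, hc, η₁, hη₁, H⟩ := h1
  exact ⟨η₁, hη₁, fun η hη hη1 => ⟨c, hc, H η hη hη1⟩⟩

/-- **S1⁺_loc is the hard-sphere instance of the summit-wide majority kernel.**  The majority form of
`PositiveZeroMode` (stmt-12839 with `∃ c > 1/2`, every admissible `v`, density-dependent constant — the
hypothesis of `boseEinsteinCondensation_of_majorityPositiveZeroMode`, p166887) specialises at `v := HS₁`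
(admissible: `isRepulsiveFiniteRange_unitHardSphere`) to S1⁺_loc verbatim. [folklore] -/
theorem localMajority_of_generalMajority
    (h : ∀ v : ℝ → ENNReal, Literature.MathematicalPhysics.QuantumManyBody.BoseGas.IsRepulsiveFiniteRange v → ∃ ρ₀ : ℝ, 0 < ρ₀ ∧ ∀ ρ : ℝ, 0 < ρ → ρ < ρ₀ → ∃ c : ℝ, 1 / 2 < c ∧ ∀ᶠ N : ℕ in Filter.atTop, ∃ δ : ENNReal, 0 < δ ∧ ∀ Ψ : Literature.MathematicalPhysics.QuantumManyBody.BoseGas.TrialState N (Literature.MathematicalPhysics.QuantumManyBody.BoseGas.sideLength ρ N), Literature.MathematicalPhysics.QuantumManyBody.BoseGas.energy v Ψ ≤ Literature.MathematicalPhysics.QuantumManyBody.BoseGas.groundStateEnergy v N (Literature.MathematicalPhysics.QuantumManyBody.BoseGas.sideLength ρ N) + δ → (∀ X, Ψ.ψ X = (‖Ψ.ψ X‖ : ℂ)) → ENNReal.ofReal (c * N) ≤ Literature.MathematicalPhysics.QuantumManyBody.BoseGas.occupation N ((Literature.MathematicalPhysics.QuantumManyBody.BoseGas.box (Literature.MathematicalPhysics.QuantumManyBody.BoseGas.sideLength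 ρ N)).indicator fun _ => ((Real.sqrt (Literature.MathematicalPhysics.QuantumManyBody.BoseGas.sideLength ρ N ^ 3))⁻¹ : ℂ)) Ψ.ψ) :
    ∃ η₁ : ℝ, 0 < η₁ ∧ ∀ η : ℝ, 0 < η → η < η₁ → ∃ c : ℝ, 1 / 2 < c ∧ ∀ᶠ N : ℕ in Filter.atTop, ∃ δ : ENNReal, 0 < δ ∧ ∀ Φ : Literature.MathematicalPhysics.QuantumManyBody.BoseGas.TrialState N (Literature.MathematicalPhysics.QuantumManyBody.BoseGas.sideLength η N), Literature.MathematicalPhysics.QuantumManyBody.BoseGas.energy (Set.indicator (Set.Iic 1) (fun _ : ℝ => (⊤ : ENNReal))) Φ ≤ Literature.MathematicalPhysics.QuantumManyBody.BoseGas.groundStateEnergy (Set.indicator (Set.Iic 1) (fun _ : ℝ => (⊤ : ENNReal))) N (Literature.MathematicalPhysics.QuantumManyBody.BoseGas.sideLength η N) + δ → (∀ X, Φ.ψ X = (‖Φ.ψ X‖ : ℂ)) → ENNReal.ofReal (c * N) ≤ Literature.MathematicalPhysics.QuantumManyBody.BoseGas.occupation N ((Literature.MathematicalPhysics.QuantumManyBody.BoseGas.box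 (Literature.MathematicalPhysics.QuantumManyBody.BoseGas.sideLength η N)).indicator fun _ => ((Real.sqrt (Literature.MathematicalPhysics.QuantumManyBody.BoseGas.sideLength η N ^ 3))⁻¹ : ℂ)) Φ.ψ :=
  h _ isRepulsiveFiniteRange_unitHardSphere

end Summit.AtomisticToContinuum.BoseEinsteinCondensation.Cruxes.HardSphereBEC.MajorityLocal

end
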